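import Summits.ValiantsHypothesis.ValiantsHypothesis.Theorems.BarrierLeverAnchoredDoorHitsLowerPairsXElimStep
import Summits.ValiantsHypothesis.ValiantsHypothesis.Theorems.BarrierLeverAnchoredDoorHitsLowerPairsConjZ
import Summits.ValiantsHypothesis.ValiantsHypothesis.Theorems.BarrierLeverAnchoredDoorHitsLowerPairsMono

/-!
# Support item `AnchoredDoorHitsLowerPairs` (stmt-ValiantsHypothesis-22510), line `anchored-peeling`:
# THE X-ELIMINATION RECURSION — certificates `XCert R F`, soundness `XCert R F → some parameters make the labelled matrix nonsingular`,
# hence `det p2Entry ≠ 0` and `symbolicDet 2 ≠ 0`; the certificate class `IsXCertPair` and the residual narrowed by it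
# (part 4 of the x-elimination recursion for Conjecture Z)

Helper file (`--supports stmt-ValiantsHypothesis-22510`; cell valiant-natproofs, rung V4, 𝒟-side door (c); registered line
`Cruxes/AnchoredDoorHitsLowerPairs/Lines/anchored_peeling.lean` v26; node `Stmt.stub_conjZ` (p695484 `…ConjZ`); prover seat val-np-p1 gen 26; memo
HOME/val-np-p1/g26/MEMO-conjZ-node-valnp1-g26.md §4; certificate search lab/xcert2.py, kit j325266). Closes NO item.

THE CERTIFICATE FORMAT (`XCert R F`, rows `R` = any finite family of faces, columns `F` = labelled columns `(L, W)`):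
* `empty`: `XCert ∅ ∅`;  `leaf`: one row `U`, one column `c` with `LeafGood U c` (some parameters give a nonzero entry; the counting criterion
  `|U| ≥ ⌈|W|/2⌉` is the subject of the sequel `…XElimLeaf`);
* `step` at a variable `a` with block items `IB`, label items `IL`, exponents `eB`, `eL`, top exponents `d` and captures `cap`: no label of a column is rooted
  at `a`; every TOUCHED column has a unique top item with capture `cap c` (`IsTop`); `cap` is injective on the touched columns; and certificates for
  TOP = (rows avoiding `a`; untouched columns) and BOT = (link rows `U ∖ a`, `a ∈ U ∈ R`; captures of the touched columns).

**`good_of_xcert` (SOUNDNESS).** `XCert R F →` there are parameters `(Θ, Φ, Ψ)` and injective enumerations of `R` and `F` with `det (lmat Θ Φ Ψ u κ) ≠ 0`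
(induction: `exists_common_point` for TOP and BOT, then `exists_det_ne_zero_step`). Consequences: `det_p2Entry_ne_zero_of_xcert` (columns `(∅, w j)`:
the dominant matrix of `…P2Reduction` is nonsingular for some `Θ, Φ`), `symbolicDet_two_ne_zero_of_xcert` (K1), the certificate class `XElim.IsXCertPair`
(hit at every profile `s ≥ 2`; CAUTION: nested Hall does NOT imply a certificate — explicit 16 × 16 example in its docstring — so certificates are a
class like the weighted apex pairs, not a proof of Conjecture Z; census lab/xcert2.py: all 19 named residual pairs up to r = 128 ARE certificate pairs), and the
NARROWED RESIDUAL `Stmt.stub_ltRestNonCanonRSWX` (registered `Stmt.stub_ltRestNonCanonRSW` verbatim + `2 ≤ s` + «no certificate on either side») with the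
UNCONDITIONAL glue `stub_ltRestNonCanonRSW_of_rswx` (a 1:1 weakest-node swap candidate) and the composition by name `anchoredDoorHitsLowerPairs_of_ltRestNonCanonRSWX`.

WHAT THIS IS NOT: no certificate for a specific pair is given here; nothing on crux stmt-ValiantsHypothesis-14610 or on `VP` versus `VNP`.
-/

set_option linter.dupNamespace false

namespace Summit.ValiantsHypothesis.ValiantsHypothesis.Theorems.BarrierLever.AnchoredPeeling

open Finset MvPolynomial
open Summit.ValiantsHypothesis.ValiantsHypothesis.Theorems.BarrierLever.BrickCalculus (pexpo pexpo_def pexpo_le_iff pexpo_sub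
  pexpo_apply_castAdd pexpo_apply_natAdd)

noncomputable section

namespace XElim

variable {h : ℕ}

/-! ## 1. Certificates -/

/-- A leaf `(U; c)` is GOOD if some parameters give a nonzero entry. -/
def LeafGood (U : Finset (Fin h)) (c : LCol h) : Prop :=
  ∃ (Θ : Anchor h → ℂ) (Φ Ψ : Anchor h → Fin h → ℂ), entry Θ Φ Ψ U c ≠ 0

open Classical in
/-- **x-elimination certificates** for (rows `R`, labelled columns `F`). -/
inductive XCert : Finset (Finset (Fin h)) → Finset (LCol h) → Prop
  | empty : XCert ∅ ∅
  | leaf {U : Finset (Fin h)} {c : LCol h} (hc : LeafGood U c) : XCert {U} {c}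
  | step (a : Fin h) (R : Finset (Finset (Fin h))) (F : Finset (LCol h)) (IB : Finset (Finset (Fin h))) (IL : Finset (Anchor h))
      (eB : Finset (Fin h) → ℕ) (eL : Anchor h → ℕ) (d : LCol h → ℕ) (cap : LCol h → LCol h)
      (hlab : ∀ c ∈ F, ∀ ℓ ∈ c.1, ℓ.1 ≠ {a})
      (htop : ∀ c ∈ F, ¬ Untouched IB IL c → IsTop a IB IL eB eL c (d c) (cap c))
      (hinj : ∀ c ∈ F, ∀ c' ∈ F, ¬ Untouched IB IL c → ¬ Untouched IB IL c' → cap c = cap c' → c = c')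
      (h0 : XCert (R.filter (fun U => a ∉ U)) (F.filter (fun c => Untouched IB IL c)))
      (h1 : XCert ((R.filter (fun U => a ∈ U)).image (fun U => U.erase a)) ((F.filter (fun c => ¬ Untouched IB IL c)).image cap)) :
      XCert R F

/-- `Good R F`: some parameters and some injective enumerations of `R` and `F` give a nonsingular labelled matrix. -/
def Good (R : Finset (Finset (Fin h))) (F : Finset (LCol h)) : Prop :=
  ∃ (Θ : Anchor h → ℂ) (Φ Ψ : Anchor h → Fin h → ℂ) (n : ℕ) (u : Fin n → Finset (Fin h)) (κ : Fin n → LCol h),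
    Function.Injective u ∧ Function.Injective κ ∧ Set.range u = ↑R ∧ Set.range κ = ↑F ∧ (lmat Θ Φ Ψ u κ).det ≠ 0

/-! ## 2. Enumeration bookkeeping -/

/-- The size of an injective enumeration is the size of its range. -/
theorem card_eq_of_range_eq {α : Type*} [DecidableEq α] {n : ℕ} {u : Fin n → α} {R : Finset α} (hu : Function.Injective u)
    (hr : Set.range u = ↑R) : n = R.card := by
  have himg : Finset.univ.image u = R := by
    ext x
    rw [Finset.mem_image, ← Finset.mem_coe, ← hr, Set.mem_range]
    simp only [Finset.mem_univ, true_and]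
  rw [← himg, Finset.card_image_of_injective _ hu, Finset.card_univ, Fintype.card_fin]

/-- An injective enumeration of a finset. -/
theorem exists_enum {α : Type*} [DecidableEq α] (R : Finset α) :
    ∃ u : Fin R.card → α, Function.Injective u ∧ Set.range u = ↑R := by
  refine ⟨fun i => (R.equivFin.symm i).1, fun i j hij => R.equivFin.symm.injective (Subtype.ext hij), ?_⟩
  ext x
  constructor
  · rintro ⟨i, rfl⟩; exact (R.equivFin.symm i).2
  · intro hx; exact ⟨R.equivFin ⟨x, hx⟩, by simp⟩

variable {a : Fin h} {n₀ n₁ : ℕ} {u₀ : Fin n₀ → Finset (Fin h)} {u₁ : Fin n₁ → Finset (Fin h)} {κ₀ : Fin n₀ → LCol h} {κ₁ : Fin n₁ → LCol h}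

/-- The combined row enumeration is injective. -/
theorem rowsF_injective (hu₀ : Function.Injective u₀) (hu₁ : Function.Injective u₁) (ha₀ : ∀ i, a ∉ u₀ i) (ha₁ : ∀ i, a ∉ u₁ i) :
    Function.Injective (rowsF a u₀ u₁) := by
  intro k k' hkk
  rw [rowsF, rowsF] at hkk
  have hinj : Function.Injective (rowsS a u₀ u₁) := by
    rintro (i | i) (j | j) hij
    · rw [rowsS, Sum.elim_inl, Sum.elim_inl] at hij; rw [hu₀ hij]
    · rw [rowsS, Sum.elim_inl, Sum.elim_inr] at hij
      exact absurd (hij ▸ Finset.mem_insert_self a (u₁ j)) (ha₀ i)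
    · rw [rowsS, Sum.elim_inr, Sum.elim_inl] at hij
      exact absurd (hij.symm ▸ Finset.mem_insert_self a (u₁ i)) (ha₀ j)
    · rw [rowsS, Sum.elim_inr, Sum.elim_inr] at hij
      have : u₁ i = u₁ j := by
        rw [← Finset.erase_insert (ha₁ i), ← Finset.erase_insert (ha₁ j), hij]
      rw [hu₁ this]
  exact finSumFinEquiv.symm.injective (hinj hkk)

/-- The combined row enumeration has range `R` when `u₀` enumerates the rows avoiding `a` and `u₁` the link rows. -/
theorem range_rowsF {R : Finset (Finset (Fin h))} (hr₀ : Set.range u₀ = ↑(R.filter (fun U => a ∉ U)))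
    (hr₁ : Set.range u₁ = ↑((R.filter (fun U => a ∈ U)).image (fun U => U.erase a))) : Set.range (rowsF a u₀ u₁) = ↑R := by
  classical
  ext U
  constructor
  · rintro ⟨k, rfl⟩
    rw [rowsF]
    rcases finSumFinEquiv.symm k with i | i
    · rw [rowsS, Sum.elim_inl]
      have : u₀ i ∈ (↑(R.filter (fun U => a ∉ U)) : Set _) := by rw [← hr₀]; exact ⟨i, rfl⟩
      exact (Finset.mem_filter.mp (Finset.mem_coe.mp this)).1
    · rw [rowsS, Sum.elim_inr]
      have : u₁ i ∈ (↑((R.filter (fun U => a ∈ U)).image (fun U => U.erase a)) : Set _) := by rw [← hr₁]; exact ⟨i, rfl⟩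
      obtain ⟨V, hV, hVe⟩ := Finset.mem_image.mp (Finset.mem_coe.mp this)
      obtain ⟨hVR, haV⟩ := Finset.mem_filter.mp hV
      rw [← hVe, Finset.insert_erase haV]
      exact hVR
  · intro hU
    rw [Finset.mem_coe] at hU
    by_cases ha : a ∈ U
    · have : U.erase a ∈ Set.range u₁ := by
        rw [hr₁, Finset.mem_coe, Finset.mem_image]; exact ⟨U, Finset.mem_filter.mpr ⟨hU, ha⟩, rfl⟩
      obtain ⟨i, hi⟩ := this
      refine ⟨finSumFinEquiv (Sum.inr i), ?_⟩
      rw [rowsF, Equiv.symm_apply_apply, rowsS, Sum.elim_inr, hi, Finset.insert_erase ha]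
    · have : U ∈ Set.range u₀ := by rw [hr₀, Finset.mem_coe, Finset.mem_filter]; exact ⟨hU, ha⟩
      obtain ⟨i, hi⟩ := this
      refine ⟨finSumFinEquiv (Sum.inl i), ?_⟩
      rw [rowsF, Equiv.symm_apply_apply, rowsS, Sum.elim_inl, hi]

/-- The combined column enumeration is injective when the two ranges are disjoint. -/
theorem colsF_injective (hκ₀ : Function.Injective κ₀) (hκ₁ : Function.Injective κ₁) (hdis : ∀ i j, κ₀ i ≠ κ₁ j) :
    Function.Injective (colsF κ₀ κ₁) := by
  intro k k' hkk
  rw [colsF, colsF] at hkk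
  have hinj : Function.Injective (colsS κ₀ κ₁) := by
    rintro (i | i) (j | j) hij
    · rw [colsS, Sum.elim_inl, Sum.elim_inl] at hij; rw [hκ₀ hij]
    · rw [colsS, Sum.elim_inl, Sum.elim_inr] at hij; exact absurd hij (hdis i j)
    · rw [colsS, Sum.elim_inr, Sum.elim_inl] at hij; exact absurd hij.symm (hdis j i)
    · rw [colsS, Sum.elim_inr, Sum.elim_inr] at hij; rw [hκ₁ hij]
  exact finSumFinEquiv.symm.injective (hinj hkk)

/-- The combined column enumeration has range `F₀ ∪ F₁`. -/
theorem range_colsF {F₀ F₁ : Finset (LCol h)} (hr₀ : Set.range κ₀ = ↑F₀) (hr₁ : Set.range κ₁ = ↑F₁) :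
    Set.range (colsF κ₀ κ₁) = ↑(F₀ ∪ F₁) := by
  ext c
  rw [Finset.coe_union, Set.mem_union, ← hr₀, ← hr₁]
  constructor
  · rintro ⟨k, rfl⟩
    rw [colsF]
    rcases finSumFinEquiv.symm k with i | i
    · exact Or.inl ⟨i, rfl⟩
    · exact Or.inr ⟨i, rfl⟩
  · rintro (⟨i, rfl⟩ | ⟨i, rfl⟩)
    · exact ⟨finSumFinEquiv (Sum.inl i), by rw [colsF, Equiv.symm_apply_apply]; rfl⟩
    · exact ⟨finSumFinEquiv (Sum.inr i), by rw [colsF, Equiv.symm_apply_apply]; rfl⟩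

/-! ## 3. Soundness of the certificates -/

/-- **SOUNDNESS OF X-ELIMINATION CERTIFICATES.** -/
theorem good_of_xcert {R : Finset (Finset (Fin h))} {F : Finset (LCol h)} (hc : XCert R F) : Good R F := by
  classical
  induction hc with
  | empty =>
    refine ⟨fun _ => 0, fun _ _ => 0, fun _ _ => 0, 0, Fin.elim0, Fin.elim0, fun i => i.elim0, fun i => i.elim0, ?_, ?_, ?_⟩
    · rw [Finset.coe_empty]; exact Set.range_eq_empty _
    · rw [Finset.coe_empty]; exact Set.range_eq_empty _
    · rw [Matrix.det_isEmpty]; exact one_ne_zero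
  | leaf hleaf =>
    rename_i U c
    obtain ⟨Θ, Φ, Ψ, hne⟩ := hleaf
    refine ⟨Θ, Φ, Ψ, 1, fun _ => U, fun _ => c, fun i j _ => Subsingleton.elim i j, fun i j _ => Subsingleton.elim i j, ?_, ?_, ?_⟩
    · rw [Finset.coe_singleton]; ext x; simp
    · rw [Finset.coe_singleton]; ext x; simp
    · rw [Matrix.det_unique, lmat, Matrix.of_apply]; exact hne
  | step a R F IB IL eB eL d cap hlab htop hinj h0 h1 ih0 ih1 =>
    obtain ⟨Θa, Φa, Ψa, n₀, u₀, κ₀, hu₀, hκ₀, hru₀, hrκ₀, hd₀⟩ := ih0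
    obtain ⟨Θb, Φb, Ψb, n₁, u₁, κ₁', hu₁, hκ₁', hru₁, hrκ₁', hd₁⟩ := ih1
    -- common base parameters
    obtain ⟨Θ₀, Φ₀, Ψ₀, hd₀', hd₁'⟩ := exists_common_point u₀ κ₀ u₁ κ₁' ⟨Θa, Φa, Ψa, hd₀⟩ ⟨Θb, Φb, Ψb, hd₁⟩
    -- enumerate the touched columns compatibly with the enumeration of their captures
    set T : Finset (LCol h) := F.filter (fun c => ¬ Untouched IB IL c) with hT
    have hpre : ∀ j, ∃ c, c ∈ T ∧ cap c = κ₁' j := by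
      intro j
      have : κ₁' j ∈ (↑(T.image cap) : Set (LCol h)) := by rw [← hrκ₁']; exact ⟨j, rfl⟩
      obtain ⟨c, hc, hcj⟩ := Finset.mem_image.mp (Finset.mem_coe.mp this)
      exact ⟨c, hc, hcj⟩
    choose κ₁ hκ₁T hκ₁cap using hpre
    have hκ₁ : Function.Injective κ₁ := fun j j' hjj => hκ₁' (by rw [← hκ₁cap j, ← hκ₁cap j', hjj])
    -- the hypotheses of the step
    have ha₀ : ∀ i, a ∉ u₀ i := by
      intro i
      have : u₀ i ∈ (↑(R.filter (fun U => a ∉ U)) : Set _) := by rw [← hru₀]; exact ⟨i, rfl⟩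
      exact (Finset.mem_filter.mp (Finset.mem_coe.mp this)).2
    have ha₁ : ∀ i, a ∉ u₁ i := by
      intro i
      have : u₁ i ∈ (↑((R.filter (fun U => a ∈ U)).image (fun U => U.erase a)) : Set _) := by rw [← hru₁]; exact ⟨i, rfl⟩
      obtain ⟨V, _, hVe⟩ := Finset.mem_image.mp (Finset.mem_coe.mp this)
      rw [← hVe]; exact Finset.notMem_erase a V
    have hκ₀F : ∀ j, κ₀ j ∈ F ∧ Untouched IB IL (κ₀ j) := by
      intro j
      have : κ₀ j ∈ (↑(F.filter (fun c => Untouched IB IL c)) : Set _) := by rw [← hrκ₀]; exact ⟨j, rfl⟩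
      exact Finset.mem_filter.mp (Finset.mem_coe.mp this)
    have hκ₁F : ∀ j, κ₁ j ∈ F ∧ ¬ Untouched IB IL (κ₁ j) := fun j => Finset.mem_filter.mp (hκ₁T j)
    have hbot : (lmat Θ₀ Φ₀ Ψ₀ u₁ (fun j => cap (κ₁ j))).det ≠ 0 := by
      have : (fun j => cap (κ₁ j)) = κ₁' := funext (fun j => hκ₁cap j)
      rw [this]; exact hd₁'
    obtain ⟨Θ, Φ, Ψ, hdet⟩ := exists_det_ne_zero_step (IB := IB) (IL := IL) (eB := eB) (eL := eL) (κ₁ := κ₁) (cap := fun j => cap (κ₁ j))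
      (d := fun j => d (κ₁ j)) ha₀ ha₁ (fun j => (hκ₀F j).2) (fun j => htop _ (hκ₁F j).1 (hκ₁F j).2)
      (fun j ℓ hℓ => hlab _ (hκ₀F j).1 ℓ hℓ) (fun j ℓ hℓ => hlab _ (hκ₁F j).1 ℓ hℓ) hd₀' hbot
    refine ⟨Θ, Φ, Ψ, n₀ + n₁, rowsF a u₀ u₁, colsF κ₀ κ₁, rowsF_injective hu₀ hu₁ ha₀ ha₁, ?_, range_rowsF hru₀ hru₁, ?_, hdet⟩
    · refine colsF_injective hκ₀ hκ₁ (fun i j heq => (hκ₁F j).2 ?_)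
      rw [← heq]; exact (hκ₀F i).2
    · have hrκ₁ : Set.range κ₁ = ↑T := by
        ext c
        constructor
        · rintro ⟨j, rfl⟩; exact Finset.mem_coe.mpr (hκ₁T j)
        · intro hc
          rw [Finset.mem_coe] at hc
          have : cap c ∈ Set.range κ₁' := by rw [hrκ₁', Finset.mem_coe, Finset.mem_image]; exact ⟨c, hc, rfl⟩
          obtain ⟨j, hj⟩ := this
          refine ⟨j, hinj _ (hκ₁F j).1 _ (Finset.mem_filter.mp hc).1 (hκ₁F j).2 (Finset.mem_filter.mp hc).2 ?_⟩
          rw [hκ₁cap j, hj]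
      rw [range_colsF hrκ₀ hrκ₁]
      congr 1
      rw [hT, Finset.filter_union_filter_not_eq]

/-! ## 4. Consequences: the dominant matrix, the symbolic minor, and the node -/

/-- **A certificate for the columns `(∅, w j)` makes the profile-2 dominant matrix `p2Entry` nonsingular for some `Θ, Φ`.** -/
theorem det_p2Entry_ne_zero_of_xcert {r : ℕ} (u w : Fin r → Finset (Fin h)) (hu : Function.Injective u) (hw : Function.Injective w)
    (hc : XCert (Finset.univ.image u) (Finset.univ.image (fun j => ((∅ : Finset (Anchor h)), w j)))) :
    ∃ (Θ : Anchor h → ℂ) (Φ : Anchor h → Fin h → ℂ), (Matrix.of fun i j : Fin r => P2.p2Entry Θ Φ (w j) (u i)).det ≠ 0 := by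
  classical
  obtain ⟨Θ, Φ, Ψ, n, u', κ', hu', hκ', hru', hrκ', hdet⟩ := good_of_xcert hc
  set κ : Fin r → LCol h := fun j => ((∅ : Finset (Anchor h)), w j) with hκ
  have hκinj : Function.Injective κ := fun j j' hjj => hw (congrArg Prod.snd hjj)
  have hn : n = r := by
    rw [card_eq_of_range_eq hu' hru', Finset.card_image_of_injective _ hu, Finset.card_univ, Fintype.card_fin]
  have hdet' := det_lmat_ne_zero_of_range_eq Θ Φ Ψ (u := u') (κ := κ') (u' := u) (κ' := κ) hu' hκinj
    (by rw [hru', Finset.coe_image, Finset.coe_univ, Set.image_univ]) (by rw [hrκ', Finset.coe_image, Finset.coe_univ, Set.image_univ]) hn hdet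
  refine ⟨Θ, Φ, ?_⟩
  have hmat : (Matrix.of fun i j : Fin r => P2.p2Entry Θ Φ (w j) (u i)) = lmat Θ Φ Ψ u κ := by
    ext i j
    rw [Matrix.of_apply, lmat, Matrix.of_apply, hκ, entry_empty_labels]
  rw [hmat]; exact hdet'

/-- **A certificate gives `symbolicDet 2 ≠ 0`** (K1, `P2.symbolicDet_two_ne_zero_of_p2Entry`). -/
theorem symbolicDet_two_ne_zero_of_xcert {r : ℕ} (u w : Fin r → Finset (Fin h)) (hu : Function.Injective u) (hw : Function.Injective w)
    (hc : XCert (Finset.univ.image u) (Finset.univ.image (fun j => ((∅ : Finset (Anchor h)), w j)))) : symbolicDet 2 h r u w ≠ 0 := by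
  obtain ⟨Θ, Φ, hdet⟩ := det_p2Entry_ne_zero_of_xcert u w hu hw hc
  exact P2.symbolicDet_two_ne_zero_of_p2Entry Θ Φ u w hdet

/-! ## 5. Certificate pairs and the narrowed residual -/

/-- **`IsXCertPair u w`: the pair (rows `u`, columns `w` without labels) has an x-elimination certificate.** CAUTION: nested Hall does NOT imply this —
rows = `∅`, ten points and the five edges `23, 27, 37, 28, 29`; columns = the full simplex `2^[4]` (r = 16, nested Hall tight at `d = 2`, numerically
nonsingular): every star of a root item has 4 columns and no union of stars has size `k ∈ {1, 2, 3, 5}` = the link sizes, so no certificate exists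
(lab/adv1.py; memo §5c). Certificate pairs are a CLASS (like the weighted apex pairs), not all of Conjecture Z. -/
def IsXCertPair {r : ℕ} (u w : Fin r → Finset (Fin h)) : Prop :=
  XCert (Finset.univ.image u) (Finset.univ.image (fun j => ((∅ : Finset (Anchor h)), w j)))

/-- **A certificate pair is hit at every profile `s ≥ 2`.** -/
theorem symbolicDet_ne_zero_of_isXCertPair {s r : ℕ} (hs : 2 ≤ s) {u w : Fin r → Finset (Fin h)} (hu : Function.Injective u) (hw : Function.Injective w)
    (hP : IsXCertPair u w) : symbolicDet s h r u w ≠ 0 :=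
  symbolicDet_ne_zero_mono hs (symbolicDet_two_ne_zero_of_xcert u w hu hw hP)

end XElim

/-- **STUB TEXT (offered): THE REGISTERED RESIDUAL MINUS X-ELIMINATION CERTIFICATE PAIRS.** The text of `Stmt.stub_ltRestNonCanonRSW` (p691725, registered
v26) VERBATIM with `2 ≤ s` in place of `1 ≤ s` and two further hypotheses: the pair has no x-elimination certificate in either orientation. WEAKER than
`Stmt.stub_ltRestNonCanonRSW` — UNCONDITIONALLY (kernel glue `stub_ltRestNonCanonRSW_of_rswx`, certificate pairs are hit by `XElim.good_of_xcert`): a 1:1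
weakest-node swap candidate. Every named residual pair of the line up to r = 128 is a certificate pair (lab/xcert2.py). WHY IT MIGHT FAIL: a data-free,
LT-free, non-canonical, non-split, non-weighted-apex pair without certificate on either side whose symbolic minor vanishes at the chosen profile. -/
def Stmt.stub_ltRestNonCanonRSWX : Prop :=
  ∃ s h₀ : ℕ, 2 ≤ s ∧ ∀ h : ℕ, h₀ ≤ h → ∀ (r : ℕ) (u w : Fin r → Finset (Fin h)),
    Function.Injective u → Function.Injective w → IsLowerSet (Set.range u) → IsLowerSet (Set.range w) → 2 ≤ r →
    (∀ (a : Fin h) (W₀ : Finset (Fin h)) (𝒜 : Finset (Finset (Fin h))) (ρ : Finset (Fin h) → Finset (Fin h)), ¬ UQFData s u w a W₀ 𝒜 ρ) →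
    (∀ (c : Fin h) (Z : Finset (Fin h)) (𝒜 : Finset (Finset (Fin h))) (ρ : Finset (Fin h) → Finset (Fin h)), ¬ UQFData s w u c Z 𝒜 ρ) →
    ¬ Summit.ValiantsHypothesis.ValiantsHypothesis.Theorems.BarrierLever.AnchoredPeeling.IsRelApexPair u w → ¬ Summit.ValiantsHypothesis.ValiantsHypothesis.Theorems.BarrierLever.AnchoredPeeling.IsRelApexPair w u → ¬ Summit.ValiantsHypothesis.ValiantsHypothesis.Theorems.BarrierLever.AnchoredPeeling.LTCert u w → ¬ Summit.ValiantsHypothesis.ValiantsHypothesis.Theorems.BarrierLever.AnchoredPeeling.LTCert w u →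
    (¬ ∃ (k : ℕ) (σ τ : Equiv.Perm (Fin h)), 1 ≤ k ∧ 2 * k + 1 ≤ h ∧ 2 ^ (k + 1) - 1 ≤ h ∧
        (∀ U : Finset (Fin h), U ∈ Set.range u ↔ Summit.ValiantsHypothesis.ValiantsHypothesis.Theorems.BarrierLever.AnchoredPeeling.DecRow k h (U.map σ.toEmbedding)) ∧
        (∀ W : Finset (Fin h), W ∈ Set.range w ↔ Summit.ValiantsHypothesis.ValiantsHypothesis.Theorems.BarrierLever.AnchoredPeeling.DecCol k h (W.map τ.toEmbedding))) →
    (¬ ∃ (k : ℕ) (σ τ : Equiv.Perm (Fin h)), 1 ≤ k ∧ 2 * k + 1 ≤ h ∧ 2 ^ (k + 1) - 1 ≤ h ∧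
        (∀ U : Finset (Fin h), U ∈ Set.range w ↔ Summit.ValiantsHypothesis.ValiantsHypothesis.Theorems.BarrierLever.AnchoredPeeling.DecRow k h (U.map σ.toEmbedding)) ∧
        (∀ W : Finset (Fin h), W ∈ Set.range u ↔ Summit.ValiantsHypothesis.ValiantsHypothesis.Theorems.BarrierLever.AnchoredPeeling.DecCol k h (W.map τ.toEmbedding))) →
    (¬ ∃ (m : ℕ) (σ τ : Equiv.Perm (Fin h)), 1 ≤ m ∧ 2 * m + 2 ≤ h ∧ 2 ^ (m + 1) + 2 ^ m - 1 ≤ h ∧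
        (∀ U : Finset (Fin h), U ∈ Set.range u ↔ Summit.ValiantsHypothesis.ValiantsHypothesis.Theorems.BarrierLever.AnchoredPeeling.SplitRow m h (U.map σ.toEmbedding)) ∧
        (∀ W : Finset (Fin h), W ∈ Set.range w ↔ Summit.ValiantsHypothesis.ValiantsHypothesis.Theorems.BarrierLever.AnchoredPeeling.SplitCol m h (W.map τ.toEmbedding))) →
    (¬ ∃ (m : ℕ) (σ τ : Equiv.Perm (Fin h)), 1 ≤ m ∧ 2 * m + 2 ≤ h ∧ 2 ^ (m + 1) + 2 ^ m - 1 ≤ h ∧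
        (∀ U : Finset (Fin h), U ∈ Set.range w ↔ Summit.ValiantsHypothesis.ValiantsHypothesis.Theorems.BarrierLever.AnchoredPeeling.SplitRow m h (U.map σ.toEmbedding)) ∧
        (∀ W : Finset (Fin h), W ∈ Set.range u ↔ Summit.ValiantsHypothesis.ValiantsHypothesis.Theorems.BarrierLever.AnchoredPeeling.SplitCol m h (W.map τ.toEmbedding))) →
    ¬ IsWApexPair u w → ¬ IsWApexPair w u →
    ¬ XElim.IsXCertPair u w → ¬ XElim.IsXCertPair w u →
    symbolicDet s h r u w ≠ 0

/-- **Kernel glue (UNCONDITIONAL; weakest-node swap candidate): the residual minus certificate pairs ⟹ the registered residual.** -/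
theorem stub_ltRestNonCanonRSW_of_rswx (hR : Stmt.stub_ltRestNonCanonRSWX) : Stmt.stub_ltRestNonCanonRSW := by
  obtain ⟨s, h₀, hs, H⟩ := hR
  refine ⟨s, h₀, le_trans (by norm_num) hs, ?_⟩
  intro h hh r u w hu hw hlu hlw hr hA hB hRA hRB hLA hLB hc hc' hd hd' hwa hwb
  by_cases hx : XElim.IsXCertPair u w
  · exact XElim.symbolicDet_ne_zero_of_isXCertPair hs hu hw hx
  · by_cases hy : XElim.IsXCertPair w u
    · exact (symbolicDet_ne_zero_comm s h r u w).mpr (XElim.symbolicDet_ne_zero_of_isXCertPair hs hw hu hy)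
    · exact H h hh r u w hu hw hlu hlw hr hA hB hRA hRB hLA hLB hc hc' hd hd' hwa hwb hx hy

/-- **Composition BY NAME: the residual minus certificate pairs ⟹ the support item `AnchoredDoorHitsLowerPairs`.** -/
theorem anchoredDoorHitsLowerPairs_of_ltRestNonCanonRSWX (hR : Stmt.stub_ltRestNonCanonRSWX) :
    Summit.ValiantsHypothesis.ValiantsHypothesis.Theses.BarrierLever.AnchoredDoorHitsLowerPairs :=
  anchoredDoorHitsLowerPairs_of_ltRestNonCanonRSW (stub_ltRestNonCanonRSW_of_rswx hR)

end

end Summit.ValiantsHypothesis.ValiantsHypothesis.Theorems.BarrierLever.AnchoredPeeling
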